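import Mathlib
import HarnessLib
import Literature.Probability.MarkovChains.QMatrix
import Literature.Probability.MarkovChains.KolmogorovEquations
import Literature.Probability.MarkovChains.SpectralGapVariational
import Literature.Probability.MarkovChains.LpDistance

/-!
# The heat kernel `H_t = e^{rt(P−I)}`: variance decay `‖H_t f − E_π f‖₂² ≤ e^{−2γrt} Var_π(f)` and the pointwise bound `|H_t(x,y) − π(y)| ≤ √(π(y)/π(x)) e^{−γrt}` (Levin–Peres–Wilmer, §20.1, Lemma 20.5, Theorem 20.6)

HONEST FRAMING: exact (Metropolis-corrected) sampling algorithms for lattice gauge theory; figures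
of merit are autocorrelation/cost numbers at stated couplings and volumes; no continuum-physics claim.

Source: D. A. Levin, Y. Peres (with E. L. Wilmer), *Markov Chains and Mixing Times*, 2nd ed., AMS
2017 [LevinPeres2017], Chapter 20 "Continuous-Time Chains": §20.1 (the generator `Q = r(P − I)` of
"`P` run at rate `r`", the heat kernel `H_t(x,y) = P_x{X_t = y}`, eqs. (20.5) `H_t(x,y) =
Σ_k e^{−rt}(rt)ᵏ/k! Pᵏ(x,y)`, (20.6) `H_t = e^{rt(P−I)} = e^{tQ}`, (20.7) `d/dt H_tf = H_tQf =
QH_tf`, (20.8) `H_tφ = e^{−r(1−λ)t}φ` for `Pφ = λφ`) and §20.3 LEMMA 20.5 with its proof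
(p. 284: `u(t) = ‖H_tf‖₂²`, `u′(t) = −2r𝓔(H_tf) ≤ −2rγu(t)` by Lemma 13.7, integrate) and
THEOREM 20.6 eq. (20.18) with its proof (p. 285: `H_tf_x(y) = H_t(y,x)/π(x)` for
`f_x = 1_{x}/π(x)`, `H_t(x,y)/π(y) − 1 = ⟨H_{t/2}f_x − 1, H_{t/2}f_y − 1⟩_π`, Cauchy–Schwarz and
(20.20) `‖H_{t/2}f_x − 1‖₂² ≤ e^{−γt}(1−π(x))/π(x) ≤ e^{−γt}/π(x)`).  Everything is PROVED (0 named
facts).  Vocabulary: `IsRowStochastic`, `IsStationary`, `DetailedBalance`,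
`piInner`, `dirichletForm`, `lawMean`, `lawVariance`, `spectralGap` (the tree's discrete-time
files); `hasSum_exp_smul_apply`, `sum_exp_smul_apply`, `sum_mul_exp_smul_apply`,
`detailedBalance_exp_smul_apply`, `matrixExp_smul_one` (`QMatrix.lean`); the backward equation and
entrywise differentiation (`KolmogorovEquations.lean`).

* `rateGenerator P r = r(P − I)`, `heatKernel P r t = e^{t·r(P−I)}` (20.6), `heatKernelApp P r t f =
  H_tf` [cite: LevinPeres2017, §20.1 eqs. (20.6)–(20.7)];
* `heatKernel_eq_smul_exp`, `heatKernel_apply_hasSum` — (20.5) `H_t = e^{−rt}e^{rtP}`,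
  `H_t(x,y) = Σ_k e^{−rt}(rt)ᵏ/k! Pᵏ(x,y)` [cite: LevinPeres2017, §20.1 eq. (20.5)];
* `sum_heatKernel`, `heatKernel_nonneg`, `heatKernel_stationary`, `heatKernel_detailedBalance` —
  `H_t` is a transition matrix with the same stationary (and reversible) law ("A probability `π` is
  stationary for `P` if and only if `πQ = 0`"; "The reader should check that `π(x)H_t(x,y) =
  π(y)H_t(y,x)`") [cite: LevinPeres2017, §20.1; §20.3 proof of Thm 20.6];
* `hasDerivAt_heatKernelApp` — (20.7) `d/dt H_tf(x) = (QH_tf)(x)` [cite: LevinPeres2017, §20.1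
  eq. (20.7)];
* `heatKernelApp_eigenfunction` — (20.8) [cite: LevinPeres2017, §20.1 eq. (20.8)];
* **LEMMA 20.5** `LevinPeres2017_lemma_20_5` — for reversible irreducible `P` with spectral gap `γ`
  and `t ≥ 0`: `‖H_tf − E_π(f)‖₂² ≤ e^{−2γrt} Var_π(f)` [cite: LevinPeres2017, §20.3 Lemma 20.5];
* `heatKernel_semigroup` (`H_{s+t} = H_sH_t`), `heatKernelApp_indicator`, `lawMean_indicator`,
  `lawVariance_indicator` (`E_π f_x = 1`, `Var_π f_x = (1 − π(x))/π(x)`), `piInner_colDensity_sub_one`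
  (the identity `⟨H_sf_x − 1, H_sf_y − 1⟩_π = H_{2s}(x,y)/π(y) − 1`), `piInner_colDensity_sub_one_self_le`
  ((20.20)) and **THEOREM 20.6, eq. (20.18)** `LevinPeres2017_thm_20_6` — for reversible irreducible
  `P` with spectral gap `γ`, `r, t ≥ 0`: `|H_t(x,y) − π(y)| ≤ √(π(y)/π(x)) e^{−γrt}`
  [cite: LevinPeres2017, §20.3 Thm 20.6 eq. (20.18)] (Cauchy–Schwarz is `piInner_sq_le_mul` of
  `LpDistance.lean`).

NOT CLAIMED: the mixing-time corollary (20.19) `t_mix^cont(ε) ≤ log(1/(ε π_min))/γ` (no continuous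
mixing-time object is introduced in this file).

DECLARED DEVIATION: none in substance — the printed proof's differential inequality
`u′ ≤ −2rγu` is integrated as "`t ↦ e^{2γrt}u(t)` has non-positive derivative, hence is
non-increasing" (Mathlib `antitone_of_deriv_nonpos`).

Context (cell pub-lqcd, venture LatticeQCDFlow): the continuous-time (Poissonised) version of a
reversible update decorrelates every observable at rate `γr` in `L²(π)` — the statement behind
quoting `1/γ` as THE relaxation time irrespective of laziness/periodicity conventions.
-/

namespace Literature.Probability.MarkovChains

open Finset Matrix NormedSpace

variable {X : Type*} [Fintype X] [DecidableEq X] {P : Matrix X X ℝ} {π : X → ℝ} {r : ℝ}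

section HeatKernel

open scoped Matrix.Norms.Operator

/-- The generator of "`P` run at rate `r`": `Q = r(P − I)`. [cite: LevinPeres2017, §20.1
("With this transition matrix, `Q = r(P − I)`")] -/
noncomputable def rateGenerator (P : Matrix X X ℝ) (r : ℝ) : Matrix X X ℝ := r • (P - 1)

/-- The heat kernel `H_t = e^{tQ} = e^{rt(P−I)}`. [cite: LevinPeres2017, §20.1 eq. (20.6)] -/
noncomputable def heatKernel (P : Matrix X X ℝ) (r t : ℝ) : Matrix X X ℝ :=
  exp (t • rateGenerator P r)

/-- `H_tf(x) = Σ_y H_t(x,y)f(y)`. [cite: LevinPeres2017, §20.3 (before Lemma 20.5)] -/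
noncomputable def heatKernelApp (P : Matrix X X ℝ) (r t : ℝ) (f : X → ℝ) : X → ℝ :=
  heatKernel P r t *ᵥ f

omit [Fintype X] in
/-- `Qg = r(Pg − g)`. [cite: LevinPeres2017, §20.1 (`Q = r(P − I)`)] -/
theorem rateGenerator_mulVec [Fintype X] (P : Matrix X X ℝ) (r : ℝ) (g : X → ℝ) :
    rateGenerator P r *ᵥ g = r • (P *ᵥ g - g) := by
  rw [rateGenerator, smul_mulVec, sub_mulVec, one_mulVec]

/-- **(20.5)–(20.6): `H_t = e^{−rt} e^{rtP}`** (`tQ = rtP + (−rt)I`, commuting summands).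
[cite: LevinPeres2017, §20.1 eqs. (20.5)–(20.6)] -/
theorem heatKernel_eq_smul_exp (P : Matrix X X ℝ) (r t : ℝ) :
    heatKernel P r t = Real.exp (-(r * t)) • exp ((r * t) • P) := by
  have hsplit : t • rateGenerator P r = (r * t) • P + (-(r * t)) • (1 : Matrix X X ℝ) := by
    rw [rateGenerator, smul_smul]; module
  have hcomm : Commute ((r * t) • P) ((-(r * t)) • (1 : Matrix X X ℝ)) :=
    (Commute.one_right _).smul_right _ |>.smul_left _
  rw [heatKernel, hsplit, Matrix.exp_add_of_commute _ _ hcomm, matrixExp_smul_one, Matrix.mul_smul,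
    mul_one]

/-- **(20.5): `H_t(x,y) = Σ_k e^{−rt}(rt)ᵏ/k! Pᵏ(x,y)`.** [cite: LevinPeres2017, §20.1 eq. (20.5)] -/
theorem heatKernel_apply_hasSum (P : Matrix X X ℝ) (r t : ℝ) (x y : X) :
    HasSum (fun k : ℕ => Real.exp (-(r * t)) * ((r * t) ^ k / k.factorial * (P ^ k) x y))
      (heatKernel P r t x y) := by
  rw [heatKernel_eq_smul_exp, Matrix.smul_apply, smul_eq_mul]
  exact (hasSum_exp_smul_apply P (r * t) x y).mul_left _

/-- `Σ_y H_t(x,y) = 1` for a transition matrix `P`. [cite: LevinPeres2017, §20.1 (`H_t(x,y) =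
P_x{X_t = y}`)] -/
theorem sum_heatKernel (hP : IsRowStochastic P) (r t : ℝ) (x : X) : ∑ y, heatKernel P r t x y = 1 := by
  simp_rw [heatKernel_eq_smul_exp, Matrix.smul_apply, smul_eq_mul, ← mul_sum, sum_exp_smul_apply hP,
    ← Real.exp_add, neg_add_cancel, Real.exp_zero]

/-- `H_t(x,y) ≥ 0` for `rt ≥ 0`. [cite: LevinPeres2017, §20.1 eq. (20.5)] -/
theorem heatKernel_nonneg (hP : IsRowStochastic P) {r t : ℝ} (hrt : 0 ≤ r * t) (x y : X) :
    0 ≤ heatKernel P r t x y := by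
  rw [heatKernel_eq_smul_exp, Matrix.smul_apply, smul_eq_mul]
  exact mul_nonneg (Real.exp_pos _).le (exp_smul_apply_nonneg hP.1 hrt x y)

/-- `H_t 1 = 1`: `H_t(f − c) = H_tf − c` for a constant `c`. [cite: LevinPeres2017, §20.3, proof of
Lemma 20.5 ("If `E_π(f) ≠ 0`, apply the above result to the function `f − E_π(f)`")] -/
theorem heatKernelApp_sub_const (hP : IsRowStochastic P) (r t : ℝ) (f : X → ℝ) (c : ℝ) (x : X) :
    heatKernelApp P r t (fun y => f y - c) x = heatKernelApp P r t f x - c := by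
  simp only [heatKernelApp, mulVec, dotProduct, mul_sub, sum_sub_distrib]
  rw [← sum_mul, sum_heatKernel hP, one_mul]

/-- `πH_t = π` for `π` stationary ("A probability `π` is stationary for `P` if and only if
`πQ = 0`"). [cite: LevinPeres2017, §20.1; Thm 20.1 (`πH_t = π` for all `t ≥ 0`)] -/
theorem heatKernel_stationary (hπ : IsStationary π P) (r t : ℝ) (y : X) :
    ∑ x, π x * heatKernel P r t x y = π y := by
  simp_rw [heatKernel_eq_smul_exp, Matrix.smul_apply, smul_eq_mul]
  have h := sum_mul_exp_smul_apply (K := P) (pi := π) hπ (r * t) y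
  calc ∑ x, π x * (Real.exp (-(r * t)) * exp ((r * t) • P) x y)
      = Real.exp (-(r * t)) * ∑ x, π x * exp ((r * t) • P) x y := by
        rw [mul_sum]; exact sum_congr rfl fun x _ => by ring
    _ = π y := by rw [h, ← mul_assoc, ← Real.exp_add, neg_add_cancel, Real.exp_zero, one_mul]

/-- `π(x)H_t(x,y) = π(y)H_t(y,x)` for a reversible `P` ("The reader should check that …").
[cite: LevinPeres2017, §20.3, proof of Thm 20.6] -/
theorem heatKernel_detailedBalance (hDB : DetailedBalance π P) (r t : ℝ) :
    DetailedBalance π (heatKernel P r t) := by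
  intro x y
  rw [heatKernel_eq_smul_exp, Matrix.smul_apply, Matrix.smul_apply, smul_eq_mul, smul_eq_mul,
    mul_left_comm, detailedBalance_exp_smul_apply hDB (r * t) x y, mul_left_comm]

/-- The mean is preserved: `E_π(H_tf) = E_π(f)`. [cite: LevinPeres2017, §20.3, proof of Lemma 20.5] -/
theorem lawMean_heatKernelApp (hπ : IsStationary π P) (r t : ℝ) (f : X → ℝ) :
    lawMean π (heatKernelApp P r t f) = lawMean π f := by
  simp only [lawMean, heatKernelApp, mulVec, dotProduct, mul_sum]
  rw [sum_comm]
  refine sum_congr rfl fun y _ => ?_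
  calc ∑ x, π x * (heatKernel P r t x y * f y) = (∑ x, π x * heatKernel P r t x y) * f y := by
        rw [sum_mul]; exact sum_congr rfl fun x _ => by ring
    _ = π y * f y := by rw [heatKernel_stationary hπ]

/-- **(20.7), matrix form:** `d/dt H_t = QH_t`. [cite: LevinPeres2017, §20.1 eq. (20.7)] -/
theorem hasDerivAt_heatKernel (P : Matrix X X ℝ) (r t : ℝ) :
    HasDerivAt (fun u : ℝ => heatKernel P r u) (rateGenerator P r * heatKernel P r t) t :=
  Norris1997_thm_2_1_1_backward (rateGenerator P r) t

/-- **(20.7): `d/dt H_tf(x) = (QH_tf)(x)`.** [cite: LevinPeres2017, §20.1 eq. (20.7); §20.3 eq.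
(20.17)] -/
theorem hasDerivAt_heatKernelApp (P : Matrix X X ℝ) (r t : ℝ) (f : X → ℝ) (x : X) :
    HasDerivAt (fun u : ℝ => heatKernelApp P r u f x)
      ((rateGenerator P r *ᵥ heatKernelApp P r t f) x) t := by
  have h : ∀ y, HasDerivAt (fun u : ℝ => heatKernel P r u x y * f y)
      ((rateGenerator P r * heatKernel P r t) x y * f y) t :=
    fun y => (hasDerivAt_apply_of_hasDerivAt (hasDerivAt_heatKernel P r t) x y).mul_const (f y)
  have e : (rateGenerator P r *ᵥ heatKernelApp P r t f) x =
      ∑ y, (rateGenerator P r * heatKernel P r t) x y * f y := by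
    rw [heatKernelApp, mulVec_mulVec]; rfl
  rw [e]
  show HasDerivAt (fun u : ℝ => ∑ y, heatKernel P r u x y * f y) _ t
  exact HasDerivAt.fun_sum fun y _ => h y

end HeatKernel

/-! ## (20.8): eigenfunctions -/

section Eigen

open scoped Matrix.Norms.Operator

/-- `Pᵏφ = λᵏφ` for an eigenfunction. [cite: LevinPeres2017, §20.1 (eigenfunctions of `P` and `Q`)] -/
theorem pow_mulVec_of_eigen {φ : X → ℝ} {lam : ℝ} (h : P *ᵥ φ = lam • φ) :
    ∀ k : ℕ, P ^ k *ᵥ φ = lam ^ k • φ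
  | 0 => by rw [pow_zero, one_mulVec, pow_zero, one_smul]
  | k + 1 => by
    rw [pow_succ, ← mulVec_mulVec, h, mulVec_smul, pow_mulVec_of_eigen h k, smul_smul, pow_succ']

/-- **(20.8):** if `Pφ = λφ` then `H_tφ = e^{−r(1−λ)t}φ`. [cite: LevinPeres2017, §20.1 eq. (20.8)] -/
theorem heatKernelApp_eigenfunction {φ : X → ℝ} {lam : ℝ} (h : P *ᵥ φ = lam • φ) (r t : ℝ)
    (x : X) : heatKernelApp P r t φ x = Real.exp (-(r * (1 - lam) * t)) * φ x := by
  -- entrywise series: `(e^{rtP}φ)(x) = Σ_k (rt)ᵏ/k! (Pᵏφ)(x) = Σ_k (rtλ)ᵏ/k! φ(x) = e^{rtλ}φ(x)`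
  have h1 : HasSum (fun k : ℕ => ∑ y, (r * t) ^ k / k.factorial * (P ^ k) x y * φ y)
      (∑ y, exp ((r * t) • P) x y * φ y) :=
    hasSum_sum fun y _ => (hasSum_exp_smul_apply P (r * t) x y).mul_right (φ y)
  have h2 : HasSum (fun k : ℕ => (r * t * lam) ^ k / k.factorial * φ x)
      (Real.exp (r * t * lam) * φ x) := by
    rw [Real.exp_eq_exp_ℝ]
    exact (NormedSpace.expSeries_div_hasSum_exp (r * t * lam)).mul_right (φ x)
  have e : (fun k : ℕ => ∑ y, (r * t) ^ k / k.factorial * (P ^ k) x y * φ y) =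
      fun k : ℕ => (r * t * lam) ^ k / k.factorial * φ x := by
    funext k
    have hk := congrFun (pow_mulVec_of_eigen h k) x
    simp only [mulVec, dotProduct, Pi.smul_apply, smul_eq_mul] at hk
    calc ∑ y, (r * t) ^ k / k.factorial * (P ^ k) x y * φ y
        = (r * t) ^ k / k.factorial * ∑ y, (P ^ k) x y * φ y := by
          rw [mul_sum]; exact sum_congr rfl fun y _ => by ring
      _ = (r * t * lam) ^ k / k.factorial * φ x := by rw [hk, mul_pow]; ring
  rw [e] at h1
  have h3 := h1.unique h2
  rw [heatKernelApp, heatKernel_eq_smul_exp, smul_mulVec, Pi.smul_apply, smul_eq_mul]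
  change Real.exp (-(r * t)) * ∑ y, exp ((r * t) • P) x y * φ y = _
  rw [h3, ← mul_assoc, ← Real.exp_add]
  congr 1
  ring_nf

end Eigen

/-! ## Lemma 20.5 -/

omit [DecidableEq X] in
/-- `‖g‖₂² = Var_π(g)` when `E_π(g) = 0`. [cite: LevinPeres2017, §20.3, proof of Lemma 20.5
("First, assume that `E_π(f) = 0`")] -/
theorem piInner_self_eq_lawVariance_of_lawMean_eq_zero {g : X → ℝ} (hg : lawMean π g = 0) :
    piInner π g g = lawVariance π g := by
  rw [← piInner_centred_eq_lawVariance π g]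
  simp [hg]

/-- The derivative of `u(t) = ‖H_tf‖₂²`: `u′(t) = 2⟨H_tf, QH_tf⟩_π = −2r𝓔(H_tf)` (20.17).
[cite: LevinPeres2017, §20.3, proof of Lemma 20.5 (the display for `u′(t)`)] -/
theorem hasDerivAt_piInner_heatKernelApp (hP : IsRowStochastic P) (hπ : IsStationary π P) (r : ℝ)
    (f : X → ℝ) (t : ℝ) :
    HasDerivAt (fun u : ℝ => piInner π (heatKernelApp P r u f) (heatKernelApp P r u f))
      (-(2 * r * dirichletForm π P (heatKernelApp P r t f))) t := by
  set g := heatKernelApp P r t f with hg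
  have hx : ∀ x, HasDerivAt (fun u : ℝ => π x * (heatKernelApp P r u f x * heatKernelApp P r u f x))
      (π x * ((rateGenerator P r *ᵥ g) x * g x + g x * (rateGenerator P r *ᵥ g) x)) t := fun x =>
    ((hasDerivAt_heatKernelApp P r t f x).mul (hasDerivAt_heatKernelApp P r t f x)).const_mul (π x)
  have e : ∑ x ∈ univ, π x * ((rateGenerator P r *ᵥ g) x * g x + g x * (rateGenerator P r *ᵥ g) x) =
      -(2 * r * dirichletForm π P g) := by
    rw [dirichletForm_eq hP hπ g, rateGenerator_mulVec]
    simp only [piInner, Pi.smul_apply, Pi.sub_apply, smul_eq_mul]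
    rw [show (2 : ℝ) * r * (∑ x, π x * (g x * g x) - ∑ x, π x * (g x * (P *ᵥ g) x)) =
      ∑ x, 2 * r * (π x * (g x * g x)) - ∑ x, 2 * r * (π x * (g x * (P *ᵥ g) x)) by
        rw [← mul_sum, ← mul_sum, mul_sub], ← sum_sub_distrib, ← sum_neg_distrib]
    exact sum_congr rfl fun x _ => by ring
  rw [← e]
  show HasDerivAt (fun u : ℝ => ∑ x, π x * (heatKernelApp P r u f x * heatKernelApp P r u f x)) _ t
  exact HasDerivAt.fun_sum fun x _ => hx x

/-- **LEMMA 20.5, mean-zero case:** `E_π(f) = 0` ⇒ `‖H_tf‖₂² ≤ e^{−2γrt}‖f‖₂²` for `t ≥ 0`.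
[cite: LevinPeres2017, §20.3 Lemma 20.5 (proof: `u′(t) ≤ −2rγu(t)`, "Integrating `u′(t)/u(t)` …")] -/
theorem LevinPeres2017_lemma_20_5_meanZero [Nontrivial X] (hπ : ∀ x, 0 < π x) (hπ1 : ∑ x, π x = 1)
    (hP : IsRowStochastic P) (hDB : DetailedBalance π P) {r : ℝ} (hr : 0 ≤ r) {f : X → ℝ}
    (hf : lawMean π f = 0) {t : ℝ} (ht : 0 ≤ t) :
    piInner π (heatKernelApp P r t f) (heatKernelApp P r t f) ≤
      Real.exp (-(2 * spectralGap π P * r * t)) * piInner π f f := by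
  have hst : IsStationary π P := hDB.isStationary hP.2
  set γ := spectralGap π P with hγ
  -- `u(s) = ‖H_sf‖₂²`, `v(s) = e^{2γrs}u(s)` has `v′ ≤ 0`
  set u : ℝ → ℝ := fun s => piInner π (heatKernelApp P r s f) (heatKernelApp P r s f) with hu
  have hu' : ∀ s, HasDerivAt u (-(2 * r * dirichletForm π P (heatKernelApp P r s f))) s :=
    fun s => hasDerivAt_piInner_heatKernelApp hP hst r f s
  have hmean : ∀ s, lawMean π (heatKernelApp P r s f) = 0 := fun s => by
    rw [lawMean_heatKernelApp hst, hf]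
  have hkey : ∀ s, -(2 * r * dirichletForm π P (heatKernelApp P r s f)) ≤ -(2 * γ * r * u s) := by
    intro s
    have h138 := LevinPeres2017_remark_13_8 hπ hπ1 hP hDB (heatKernelApp P r s f)
    rw [← piInner_self_eq_lawVariance_of_lawMean_eq_zero (hmean s)] at h138
    have : 2 * γ * r * u s ≤ 2 * r * dirichletForm π P (heatKernelApp P r s f) := by
      calc 2 * γ * r * u s = 2 * r * (γ * u s) := by ring
        _ ≤ 2 * r * dirichletForm π P (heatKernelApp P r s f) :=
          mul_le_mul_of_nonneg_left h138 (by positivity)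
    linarith
  set v : ℝ → ℝ := fun s => Real.exp (2 * γ * r * s) * u s with hv
  have hv' : ∀ s, HasDerivAt v (Real.exp (2 * γ * r * s) * (2 * γ * r) * u s +
      Real.exp (2 * γ * r * s) * -(2 * r * dirichletForm π P (heatKernelApp P r s f))) s := by
    intro s
    have he : HasDerivAt (fun s => Real.exp (2 * γ * r * s)) (Real.exp (2 * γ * r * s) * (2 * γ * r)) s := by
      have := ((hasDerivAt_id s).const_mul (2 * γ * r)).exp
      simpa using this
    exact he.mul (hu' s)
  have hvanti : Antitone v := by
    refine antitone_of_deriv_nonpos (fun s => (hv' s).differentiableAt) fun s => ?_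
    rw [(hv' s).deriv]
    have hexp : 0 < Real.exp (2 * γ * r * s) := Real.exp_pos _
    nlinarith [hkey s]
  have hv0 : v t ≤ v 0 := hvanti ht
  simp only [hv, mul_zero, Real.exp_zero, one_mul] at hv0
  -- unwind: `u t ≤ e^{−2γrt} u 0`, and `u 0 = ‖f‖²` (`H_0 = I`)
  have hu0 : u 0 = piInner π f f := by
    simp only [hu, heatKernelApp, heatKernel, zero_smul, NormedSpace.exp_zero, one_mulVec]
  rw [hu0] at hv0
  have hexp : 0 < Real.exp (2 * γ * r * t) := Real.exp_pos _
  rw [show -(2 * γ * r * t) = -(2 * γ * r * t) by rfl, Real.exp_neg]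
  rw [le_inv_mul_iff₀ hexp]
  exact hv0

/-- **LEMMA 20.5 (Levin–Peres–Wilmer).**  Let `P` be a reversible and irreducible transition matrix
with spectral gap `γ = 1 − λ₂` (positive stationary `π`, `|X| ≥ 2`), and let `H_t` be the heat
kernel of the continuous-time chain run at rate `r ≥ 0`.  For `f ∈ ℝ^X` and `t ≥ 0`:
**`‖H_tf − E_π(f)‖₂² ≤ e^{−2γrt} Var_π(f)`**. [cite: LevinPeres2017, §20.3 Lemma 20.5] -/
theorem LevinPeres2017_lemma_20_5 [Nontrivial X] (hπ : ∀ x, 0 < π x) (hπ1 : ∑ x, π x = 1)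
    (hP : IsRowStochastic P) (hDB : DetailedBalance π P) {r : ℝ} (hr : 0 ≤ r) (f : X → ℝ) {t : ℝ}
    (ht : 0 ≤ t) :
    piInner π (fun x => heatKernelApp P r t f x - lawMean π f)
        (fun x => heatKernelApp P r t f x - lawMean π f) ≤
      Real.exp (-(2 * spectralGap π P * r * t)) * lawVariance π f := by
  -- apply the mean-zero case to `f − E_π(f)`
  have h0 : lawMean π (fun x => f x - lawMean π f) = 0 := by
    have := sum_mul_sub_lawMean hπ1 f
    simpa [lawMean] using this
  have h := LevinPeres2017_lemma_20_5_meanZero hπ hπ1 hP hDB hr h0 ht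
  have e : heatKernelApp P r t (fun x => f x - lawMean π f) =
      fun x => heatKernelApp P r t f x - lawMean π f :=
    funext fun x => heatKernelApp_sub_const hP r t f _ x
  rw [e, piInner_centred_eq_lawVariance] at h
  exact h

/-! ## Theorem 20.6, eq. (20.18) -/

section PointwiseBound

open scoped Matrix.Norms.Operator

/-- **`H_{s+t} = H_sH_t`.** [cite: LevinPeres2017, §20.3, proof of Thm 20.6
(`H_t(x,y) = Σ_z H_{t/2}(x,z)H_{t/2}(z,y)`)] -/
theorem heatKernel_semigroup (P : Matrix X X ℝ) (r s t : ℝ) :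
    heatKernel P r (s + t) = heatKernel P r s * heatKernel P r t := by
  rw [heatKernel, heatKernel, heatKernel, add_smul]
  exact Matrix.exp_add_of_commute _ _ ((Commute.refl _).smul_left _ |>.smul_right _)

end PointwiseBound

/-- `H_tf_x(z) = H_t(z,x)/π(x)` for `f_x = 1_{x}/π(x)`. [cite: LevinPeres2017, §20.3, proof of
Thm 20.6 ("If `f_x(y) = 1_{y=x}/π(x)`, then `H_tf_x(y) = H_t(y,x)/π(x)`")] -/
theorem heatKernelApp_indicator (P : Matrix X X ℝ) (π : X → ℝ) (r t : ℝ) (x z : X) :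
    heatKernelApp P r t (fun y => if y = x then (π x)⁻¹ else 0) z = heatKernel P r t z x / π x := by
  simp only [heatKernelApp, mulVec, dotProduct, mul_ite, mul_zero, sum_ite_eq', mem_univ, if_true]
  rw [div_eq_mul_inv]

/-- `E_π(f_x) = 1` for `f_x = 1_{x}/π(x)`. [cite: LevinPeres2017, §20.3, proof of Thm 20.6 ("since
`E_π(f_x) = 1` and `Var_π(f_x) = (1 − π(x))/π(x)`")] -/
theorem lawMean_indicator (hπ : ∀ y, 0 < π y) (x : X) :
    lawMean π (fun y => if y = x then (π x)⁻¹ else 0) = 1 := by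
  simp only [lawMean, mul_ite, mul_zero, sum_ite_eq', mem_univ, if_true]
  exact mul_inv_cancel₀ (hπ x).ne'

/-- `Var_π(f_x) = (1 − π(x))/π(x)`. [cite: LevinPeres2017, §20.3, proof of Thm 20.6] -/
theorem lawVariance_indicator (hπ : ∀ y, 0 < π y) (hπ1 : ∑ y, π y = 1) (x : X) :
    lawVariance π (fun y => if y = x then (π x)⁻¹ else 0) = (1 - π x) / π x := by
  rw [← piInner_centred_eq_lawVariance, lawMean_indicator hπ x]
  simp only [piInner]
  have e : ∀ y, π y * (((if y = x then (π x)⁻¹ else 0) - 1) * ((if y = x then (π x)⁻¹ else 0) - 1)) =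
      (if y = x then π x * ((π x)⁻¹ - 1) ^ 2 - π x else 0) + π y := by
    intro y
    by_cases hy : y = x
    · subst hy; rw [if_pos rfl, if_pos rfl]; ring
    · simp [hy]
  have hx : π x ≠ 0 := (hπ x).ne'
  simp_rw [e, sum_add_distrib, sum_ite_eq' univ x, if_pos (mem_univ x), hπ1]
  field_simp
  ring

/-- The key identity of the proof: for a reversible `P`,
`⟨H_sf_x − 1, H_sf_y − 1⟩_π = H_{2s}(x,y)/π(y) − 1` (with `H_sf_x(z) = H_s(z,x)/π(x)`).
[cite: LevinPeres2017, §20.3, proof of Thm 20.6 (the display `H_tf_x(y) = … =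
Σ_z H_{t/2}f_x(z)·H_{t/2}f_y(z)·π(z)`)] -/
theorem piInner_colDensity_sub_one (hπ : ∀ y, 0 < π y) (hπ1 : ∑ y, π y = 1) (hP : IsRowStochastic P)
    (hDB : DetailedBalance π P) (r s : ℝ) (x y : X) :
    piInner π (fun z => heatKernel P r s z x / π x - 1) (fun z => heatKernel P r s z y / π y - 1) =
      heatKernel P r (s + s) x y / π y - 1 := by
  have hst : IsStationary π P := hDB.isStationary hP.2
  have hHDB := heatKernel_detailedBalance hDB r s
  have hx := (hπ x).ne'
  have hy := (hπ y).ne'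
  -- expand the product
  have e : ∀ z, π z * ((heatKernel P r s z x / π x - 1) * (heatKernel P r s z y / π y - 1)) =
      (π z * heatKernel P r s z x * heatKernel P r s z y) / (π x * π y)
        - (π z * heatKernel P r s z x) / π x - (π z * heatKernel P r s z y) / π y + π z := by
    intro z; field_simp; ring
  simp only [piInner, e, sum_add_distrib, sum_sub_distrib, ← sum_div, hπ1,
    heatKernel_stationary hst]
  -- `Σ_z π(z)H_s(z,x)H_s(z,y) = π(x) H_{2s}(x,y)` by reversibility and the semigroup property
  have hsg : ∑ z, π z * heatKernel P r s z x * heatKernel P r s z y = π x * heatKernel P r (s + s) x y := by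
    rw [heatKernel_semigroup, mul_apply, mul_sum]
    exact sum_congr rfl fun z _ => by rw [hHDB z x]; ring
  rw [hsg, div_self hx, div_self hy]
  field_simp
  ring

/-- (20.20): `‖H_sf_x − 1‖₂² ≤ e^{−2γrs}/π(x)`. [cite: LevinPeres2017, §20.3, proof of Thm 20.6
eq. (20.20)] -/
theorem piInner_colDensity_sub_one_self_le [Nontrivial X] (hπ : ∀ y, 0 < π y) (hπ1 : ∑ y, π y = 1)
    (hP : IsRowStochastic P) (hDB : DetailedBalance π P) {r : ℝ} (hr : 0 ≤ r) {s : ℝ} (hs : 0 ≤ s)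
    (x : X) :
    piInner π (fun z => heatKernel P r s z x / π x - 1) (fun z => heatKernel P r s z x / π x - 1) ≤
      Real.exp (-(2 * spectralGap π P * r * s)) / π x := by
  have h := LevinPeres2017_lemma_20_5 hπ hπ1 hP hDB hr (fun y => if y = x then (π x)⁻¹ else 0) hs
  simp_rw [heatKernelApp_indicator, lawMean_indicator hπ x, lawVariance_indicator hπ hπ1 x] at h
  refine h.trans ?_
  have hx := hπ x
  have hex := Real.exp_pos (-(2 * spectralGap π P * r * s))
  rw [← mul_div_assoc]
  refine div_le_div_of_nonneg_right ?_ hx.le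
  nlinarith [mul_pos hex hx]

/-- **THEOREM 20.6, eq. (20.18) (Levin–Peres–Wilmer).**  Let `P` be an irreducible and reversible
transition matrix with spectral gap `γ` (positive stationary `π`, `|X| ≥ 2`), `H_t` its heat kernel
run at rate `r ≥ 0`.  Then for `t ≥ 0`: **`|H_t(x,y) − π(y)| ≤ √(π(y)/π(x)) e^{−γrt}`**.
[cite: LevinPeres2017, §20.3 Thm 20.6 eq. (20.18)] -/
theorem LevinPeres2017_thm_20_6 [Nontrivial X] (hπ : ∀ y, 0 < π y) (hπ1 : ∑ y, π y = 1)
    (hP : IsRowStochastic P) (hDB : DetailedBalance π P) {r : ℝ} (hr : 0 ≤ r) {t : ℝ} (ht : 0 ≤ t)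
    (x y : X) :
    |heatKernel P r t x y - π y| ≤ Real.sqrt (π y / π x) * Real.exp (-(spectralGap π P * r * t)) := by
  set γ := spectralGap π P with hγ
  have hs : 0 ≤ t / 2 := by linarith
  -- Cauchy–Schwarz on the key identity at `s = t/2`
  have hkey := piInner_colDensity_sub_one hπ hπ1 hP hDB r (t / 2) x y
  rw [add_halves] at hkey
  have hcs := piInner_sq_le_mul (fun z => (hπ z).le)
    (fun z => heatKernel P r (t / 2) z x / π x - 1) (fun z => heatKernel P r (t / 2) z y / π y - 1)
  rw [hkey] at hcs
  have hbx := piInner_colDensity_sub_one_self_le hπ hπ1 hP hDB hr hs x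
  have hby := piInner_colDensity_sub_one_self_le hπ hπ1 hP hDB hr hs y
  have hAx : 0 ≤ piInner π (fun z => heatKernel P r (t / 2) z x / π x - 1)
      (fun z => heatKernel P r (t / 2) z x / π x - 1) :=
    sum_nonneg fun z _ => mul_nonneg (hπ z).le (mul_self_nonneg _)
  have hAy : 0 ≤ piInner π (fun z => heatKernel P r (t / 2) z y / π y - 1)
      (fun z => heatKernel P r (t / 2) z y / π y - 1) :=
    sum_nonneg fun z _ => mul_nonneg (hπ z).le (mul_self_nonneg _)
  have hE : -(2 * γ * r * (t / 2)) = -(γ * r * t) := by ring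
  rw [hE] at hbx hby
  -- `(H_t(x,y)/π(y) − 1)² ≤ e^{−γrt}/π(x) · e^{−γrt}/π(y) = (e^{−γrt}/√(π(x)π(y)))²`
  set E := Real.exp (-(γ * r * t)) with hEdef
  have hEpos : 0 < E := Real.exp_pos _
  have hsq : (heatKernel P r t x y / π y - 1) ^ 2 ≤ (E / Real.sqrt (π x * π y)) ^ 2 := by
    have hprod : (heatKernel P r t x y / π y - 1) ^ 2 ≤ E / π x * (E / π y) :=
      hcs.trans (mul_le_mul hbx hby hAy (le_trans hAx hbx))
    rw [div_pow, Real.sq_sqrt (mul_nonneg (hπ x).le (hπ y).le)]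
    calc (heatKernel P r t x y / π y - 1) ^ 2 ≤ E / π x * (E / π y) := hprod
      _ = E ^ 2 / (π x * π y) := by rw [div_mul_div_comm, sq]
  have hnn : 0 ≤ E / Real.sqrt (π x * π y) := div_nonneg hEpos.le (Real.sqrt_nonneg _)
  have habs : |heatKernel P r t x y / π y - 1| ≤ E / Real.sqrt (π x * π y) :=
    abs_le_of_sq_le_sq hsq hnn
  -- multiply by `π(y)`
  have hπy := hπ y
  have e1 : heatKernel P r t x y - π y = π y * (heatKernel P r t x y / π y - 1) := by
    field_simp
  rw [e1, abs_mul, abs_of_pos hπy]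
  have hsx : 0 < Real.sqrt (π x) := Real.sqrt_pos.2 (hπ x)
  have hsy : 0 < Real.sqrt (π y) := Real.sqrt_pos.2 hπy
  calc π y * |heatKernel P r t x y / π y - 1|
      ≤ π y * (E / Real.sqrt (π x * π y)) := mul_le_mul_of_nonneg_left habs hπy.le
    _ = Real.sqrt (π y / π x) * E := by
        rw [Real.sqrt_mul (hπ x).le, Real.sqrt_div (hπ y).le]
        set a := Real.sqrt (π x) with ha
        set b := Real.sqrt (π y) with hb
        have ha0 : a ≠ 0 := hsx.ne'
        have hb0 : b ≠ 0 := hsy.ne'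
        have h3 : π y = b * b := by rw [hb]; exact (Real.mul_self_sqrt hπy.le).symm
        rw [h3]
        field_simp

end Literature.Probability.MarkovChains
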